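import Summits.Langlands.Langlands.Theses.EisensteinGelfandKirillov
import Summits.Langlands.Langlands.Theorems.EisensteinGelfandKirillovProModularOfGKBoundTwoLeafFernDefs
import Summits.Langlands.Langlands.Theorems.EisensteinGelfandKirillovProModularOfGKBoundStubClosure
import Summits.Langlands.Langlands.Theorems.EisensteinGelfandKirillovProModularOfGKBoundStubHost
import Literature.NumberTheory.GaloisRepresentations.ChenevierUniversalDeterminantRing
import Literature.NumberTheory.GaloisRepresentations.GlobalPFinitenessProofs
import Summits.Langlands.Langlands.Theorems.EisensteinGelfandKirillovProModularOfGKBoundStubNoetherianOf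

/-!
# Line `two-leaf-fern` — checked skeleton for the crux `ProModularOfGKBound` (LEAD COPY, lead c2)
(item stmt-Langlands-18273 · route `route-Langlands-EisensteinGelfandKirillov`, rank 3 · sub-problem
Langlands/Langlands; planner skeleton `planner-cruxplan-stmt-Langlands-18273-two-leaf-fern-0`, 2026-08-17,
RESHAPED by lead `prover-line-stmt-Langlands-18273-c2-0`, 2026-08-17: `Host` repaired, `stub_noetherian` split
off; idea card `Cruxes/ProModularOfGKBound/Ideas/two-leaf-fern.md`, line card `Lines/two-leaf-fern.md`,
PICKED.md of lead c2).

## What the crux is, as typed (Disproof.lean anatomy, honoured)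

`ProModularOfGKBound := EisensteinGKBound → Q` with `Q` = pro-modularity of EVERY irreducible, totally
odd, a.e.-unramified `ρ : Γ_F → GL₂(ℚ̄_p)` having a residually upper-triangular `p`-distinguished
integral model `ρ₀` over `O = 𝒪_{ℚ̄_p}` (`F` totally real, `p ≥ 5`, `p ∤ disc F`):
`∃ 𝒰 : TameLevel 2 F p, 𝒰.IsPadicallyAutomorphic ρ`.  The door `EisensteinGKBound` is junk-true as
typed (level collapse, crux 18272), so by `Disproof.proModularOfGKBound_iff_proModularity_of_door` the
crux IS `Q`; accordingly this line proves `Q` outright and the composition `ProModularOfGKBound_of`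
introduces the door hypothesis and never uses it (no `_false_without_` theorem exists on this crux).

## The line (two opposite leaves span; Chenevier's infinite fern at the Eisenstein pseudo-deformation
## space, fixed determinant, ideal-theoretic form) — see the planner's card for the mechanism.

HOST.  `ℋ : Host p O ρ ρ₀` = the FIXED-DETERMINANT pseudo-deformation space of `τ̄ = tr ρ̄₀` unramified
outside `S = badSet p ρ`, posited as an INTERFACE: a compact Hausdorff local ring `R` with `p ∈ 𝔪_R`, a
continuous `2`-dimensional pseudocharacter `T : Γ_F → R` whose values topologically generate `R` (G), the
base point `base : R → ℚ̄_p` with `base ∘ T = tr ρ`, `T` unramified outside `S` (U0), every continuous point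
of determinant `σ ∘ det ρ` for some `σ ∈ Gal(ℚ̄_p/ℚ_p)` (D), and surjectivity on points (U2).  Its
CONSTRUCTION is `stub_host` (the trace algebra `R_tr ⊆ ∏_{ρ'} 𝒪_{E_ρ'}`; provable now); its Noetherianity
is `stub_noetherian` (Φ_p-finiteness ⇒ Noetherian universal pseudo-deformation ring ↠ `R`).  Geometry is
done with IDEALS of `R` (Mathlib): irreducible components of `Spec R[1/p]` through a point `x` =
`minimalPrimes R` below `ker x`; the Zariski closure of the `𝒰`-pro-modular points is `V(J_𝒰)`,
`J_𝒰 = proModularIdeal R T 𝒰 := ⨅ ker x` over continuous points `x` whose trace function is the trace of a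
`𝒰`-pro-modular representation.

RESHAPE LOG (lead c2).  Planner's `Host.det_point` demanded `x(T g)² − x(T g²) = 2·det ρ(g)` for EVERY
continuous point `x`; with the base point, `σ ∘ base` is a continuous point for every `σ ∈ Gal(ℚ̄_p/ℚ_p)`
(automorphisms of `PadicAlgCl p` are spectral-norm isometries), so that clause forces `det ρ(Γ_F) ⊆ ℚ_p`:
the planner's `stub_host` is FALSE as typed (witness `F = ℚ`, `p = 5`, `ρ = χ ⊕ 1`, `χ` the mod-7 cyclotomic
character composed with `(ℤ/7)ˣ → μ₆(ℚ̄_5)`).  Repair: (D) Galois-equivariant; (U1) "points separated by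
traces" replaced by (G) "traces generate" (implies it: `Host.separating`); `IsNoetherianRing R` moved out of
the structure into `stub_noetherian` and fed to `stub_fernCapture`/`stub_seed` as a hypothesis.  Composition
unchanged otherwise.

## Stubs (5) and composition

* H  `stub_host`        — `Nonempty (Host p O ρ ρ₀)` (the trace-algebra host).  [LANDED p166481]
* N  `stub_noetherian`  — every host of an a.e.-unramified `ρ` is Noetherian — DERIVED (reshape 3) from:
  N₀ `stub_noetherianOf` (the reduction: Chenevier's universal ring + Φ_p ⇒ N) — LANDED p169005 (+ p167803, p167997),
  N₁ `stub_chenevierRing : Chenevier2014_universalDeterminantRingTwo` (named fact, Literature; blocked: no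
     pseudo-deformation functor in the tree), N₂ `stub_phiP : galoisGroupUnramifiedOutside_phiP` — PROVED (wave 2:
     Literature `galoisGroupUnramifiedOutside_phiP_holds`, p168150).
* C  `stub_closure`     — PRO-MODULARITY IS ZARISKI-CLOSED (raw form).  [LANDED p164840]
* F  `stub_fernCapture` — THE FERN (Transfer C⁺ of the card), for Noetherian hosts.  [XL]
* S  `stub_seed`        — THE SEED (hardest; open in part), for Noetherian hosts.  [XL]

Composition `ProModularOfGKBound_of` (sorry-free, kernel-checked, stubs BY NAME): host (H) ⇒ `ℋ`;
(N) ⇒ `ℋ.R` Noetherian; seed (S) ⇒ `P₀ ≤ ker base` minimal with a good point `z`, `P₀ ≤ ker z`; fern (F) ⇒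
`J_𝒰 ≤ P₀`; hence `J_𝒰 ≤ ker base`; closure (C) ⇒ `𝒰.IsPadicallyAutomorphic ρ`.

No stub is the crux or the summit in costume: H and N are infrastructure, C concludes pro-modularity only for
points in the Zariski closure of pro-modular points, F is a statement about classical points `z` (not
about `ρ`), S asserts classical points on a component (not pro-modularity of `ρ`).
Barriers: `ModPLanglandsGL2BeyondQp(FpBar)` evaded (no `GL₂(F_v)`-representation enters any stub);
`ResiduallyReducibleBarrier` not engaged; `TaylorWilesNumericalCoincidence` replaced by
`dim leaf + dim leaf = d + d = 2d = h¹(ad⁰)`; `PatchingLocalComponentBarrier` n/a;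
`NonRegularWeightBarrier` honoured (good points are HT-regular).

VOCABULARY: imported from the landed Defs file `Theorems/EisensteinGelfandKirillovProModularOfGKBoundTwoLeafFernDefs.lean`
(p163765: `badSet`, `proModularIdeal`, `IsGoodPoint`, `Host`, API).  LANDED STUBS are imported and used BY NAME:
`stub_closure` (p164840, `Theorems/…StubClosure.lean`), `stub_host` (p166481, `Theorems/…StubHost.lean`: the trace
algebra `R_tr`, with `…StubHostTraceAlgebra(Local)`, `…StubHostAlgEquivExtend`).  RESHAPE 2 (lead c2, after wave 1): `stub_fernCapture` gains
the crux hypothesis `(∀ᶠ v in cofinite, ρ.IsUnramifiedAt v)` (worker audit `StubFernCaptureAudit.lean`: without it the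
conclusion `badSet p ρ ⊆ 𝒰.bad`, `𝒰.bad` finite, silently asserted an unintended statement about infinitely
ramified `ρ`); the composition passes `hur`.  RESHAPE 4 (lead c2, worker audit "∀ P₀ ≤ ker z over-reaches at crossing
points"): `stub_seed` also asserts that its good point lies on a UNIQUE component (`∀ P ∈ minimalPrimes, P ≤ ker z → P = P₀`)
and `stub_fernCapture` assumes it — exactly what the capture lemma consumes.  RESHAPE 3 (lead c2, after the wave-1 report on `stub_noetherian`):
the Noetherianity stub is split along its paper proof into the two published inputs it needs, now NAMED FACTS in
`Literature/NumberTheory/GaloisRepresentations/{GlobalPFiniteness,ChenevierUniversalDeterminantRing}.lean`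
(`galoisGroupUnramifiedOutside_phiP`, `Chenevier2014_universalDeterminantRingTwo`), registered as stubs
`stub_phiP`, `stub_chenevierRing`, and the reduction `stub_noetherianOf` (registered; the worker's 800-line
infrastructure proves it); `stub_noetherian` keeps its registered signature and is derived in this file.
-/

noncomputable section

open scoped NumberField Matrix
open Filter Field IsDedekindDomain
open Literature.NumberTheory.GaloisRepresentations Literature.NumberTheory.Automorphic
open Literature.NumberTheory.Automorphic.BigHeckeGLn
open Summit.Langlands.Langlands.Theses.EisensteinGelfandKirillov (ProModularOfGKBound)
open Literature.NumberTheory.GaloisRepresentations (MazurPhiP galoisGroupUnramifiedOutside_phiP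
  Chenevier2014_universalDeterminantRingTwo)

-- `Summit.Langlands.Langlands.…`: summit = sub-problem name (D-0017 nested layout), not a typo.
set_option linter.dupNamespace false
set_option autoImplicit false

namespace Summit.Langlands.Langlands.Cruxes.ProModularOfGKBound.TwoLeafFern

/-! ### Registered stubs

Statements are fully explicit (no `variable`, no local notation); the only non-tree constants they
mention are the four line-local declarations above (`badSet`, `proModularIdeal`, `IsGoodPoint`,
`Host`). -/

/-! **Stub H — `stub_host` is LANDED** (p166481,
`Summit.Langlands.Langlands.Cruxes.ProModularOfGKBound.TwoLeafFern.stub_host` in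
`Theorems/EisensteinGelfandKirillovProModularOfGKBoundStubHost.lean`, imported above: the interface is
inhabited by the trace algebra `R_tr` of the lifts of `ρ`) and used by name below. -/

/-- **Stub N₁ — `stub_chenevierRing` (NAMED FACT, Chenevier 2014).**  The universal deformation ring of a
continuous `2`-dimensional determinant of a profinite group satisfying `Φ_p`, over a finite field, is a compact
Hausdorff local NOETHERIAN ring, universal for continuous deformations to compact Hausdorff local rings
(`Literature.NumberTheory.GaloisRepresentations.Chenevier2014_universalDeterminantRingTwo`, D-0014 named fact).
Blocked in the tree: no pseudo-deformation / determinant functor and no Kaplansky theorem (compact T2 rings are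
profinite) yet.  Size: XL as a formalisation; TRUE in print.
[cite: Chenevier2014, §3.1 Lemma 3.2, Prop. 3.3, Prop. 3.7 and Example (condition (F))] -/
theorem stub_chenevierRing : Chenevier2014_universalDeterminantRingTwo := by
  sorry

/-- **Stub N₂ — `stub_phiP` (Mazur's `Φ_p` for `G_{K,S}`) — PROVED.**  For a number field `K`, a finite set `S` of
finite places and any prime `p`, every open subgroup of `G_{K,S}` has finitely many continuous homomorphisms to `ℤ/p`:
the Literature named fact `galoisGroupUnramifiedOutside_phiP` (p167095) was DISCHARGED by the wave-2 worker as
`Literature.NumberTheory.GaloisRepresentations.galoisGroupUnramifiedOutside_phiP_holds`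
(`Literature/NumberTheory/GaloisRepresentations/GlobalPFinitenessProofs.lean`, p168150: Hermite finiteness of the tree +
open subgroups of bounded index); the one-line Summit-side restatement is refused by the gate as `dedup.landed`, so the
registered stub is closed HERE by the landed theorem (no `sorry`).
[cite: Mazur1989Deforming, §1.2] [cite: Chenevier2014, §3.1 (Example: condition (F) for G_{K,S})] -/
theorem stub_phiP : galoisGroupUnramifiedOutside_phiP :=
  galoisGroupUnramifiedOutside_phiP_holds

/-! **Stub N₀ — `stub_noetherianOf` is LANDED** (p169005,
`Summit.Langlands.Langlands.Cruxes.ProModularOfGKBound.TwoLeafFern.stub_noetherianOf` in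
`Theorems/EisensteinGelfandKirillovProModularOfGKBoundStubNoetherianOf.lean`, with `…StubNoetherianCompactRing.lean` (p167803)
and `…StubNoetherianDeterminant.lean` (p167997): compact local rings, descent of the pseudocharacter to `G_{F,S}`, dim-2
pseudocharacter ⇒ Chenevier determinant, surjectivity of the classifying map; wave-2 worker) and used by name below. -/

/-- **Stub N — `stub_noetherian` (HOSTS ARE NOETHERIAN)**, registered signature unchanged, now DERIVED from
the registered stubs N₀, N₁, N₂ by name (no `sorry` of its own). [cite: Chenevier2014, §3.1 Prop. 3.3] -/
theorem stub_noetherian :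
    ∀ (F : Type) [Field F] [NumberField F] (p : ℕ) [Fact p.Prime], 5 ≤ p →
    ∀ (O : ValuationSubring (PadicAlgCl p)),
      O = (Valued.v : Valuation (PadicAlgCl p) NNReal).valuationSubring →
    ∀ (ρ : FramedGaloisRep F (PadicAlgCl p) 2) (ρ₀ : absoluteGaloisGroup F →* GL (Fin 2) O),
      ρ.HasUpperTriangularIntegralModel ρ₀ →
      (∀ᶠ v in cofinite, ρ.IsUnramifiedAt v) →
    ∀ (ℋ : Host p O ρ ρ₀), IsNoetherianRing ℋ.R :=
  stub_noetherianOf stub_chenevierRing stub_phiP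

/-! **Stub C — `stub_closure` is LANDED** (p164840,
`Summit.Langlands.Langlands.Cruxes.ProModularOfGKBound.TwoLeafFern.stub_closure` in
`Theorems/EisensteinGelfandKirillovProModularOfGKBoundStubClosure.lean`, imported above) and used by name below. -/

/-- **Stub F — `stub_fernCapture` (THE TWO-LEAF FERN; Transfer C⁺ of the card).**  `F` totally real,
`p ≥ 5` unramified in `F`, `ρ, ρ₀` as in the crux (residually upper-triangular `O`-model, a.e. unramified — RESHAPE 2 —,
`p`-distinguished), `ℋ` a NOETHERIAN host.  For every continuous point `z` of `ℋ` whose trace function is the trace of a GOOD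
representation `ρ_z` (`IsGoodPoint`: a `p`-adic twist of a strongly irreducible, nearly ordinary,
HT-regular classical `ρ_c`) lying on a UNIQUE irreducible component `V(P₀)` of the generic fibre (RESHAPE 4:
`P₀` the only minimal prime below `ker z` — a smooth point; the capture step needs exactly this, and the seed
supplies it), there is a tame level `𝒰` with `𝒰.bad ⊇ badSet p ρ` whose
pro-modular ideal lies in `P₀`: the component is in the Zariski closure of the `𝒰`-pro-modular points.
Mechanism: determinant-normalised Hida leaf through `z` (dim `d`) ⊆ `V(J_𝒰)` (dictionary classical ⇒
pro-modular at a level adapted to `S`, closure under continuous twists) and ⊆ `V(P₀)` (`z` smooth: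
Newton–Thorne + Kisin ⇒ `(ℋ.R[1/p])^∧_z` regular of dimension `2d`, unique minimal prime below `ker z`);
at a Zariski-dense set of classical `z'` on the leaf (BGV genericity) the OPPOSITE-refinement leaf exists and
the two tangent spaces (each of dimension `d`, meeting in `H¹_f(F, ad⁰ρ_{z'}) = 0`: Newton–Thorne Thm 2 +
Nakamura's local two-leaf lemma for ANY `F_v`) span `H¹(G_{F,S}, ad⁰ρ_{z'})` (`twoLeaf_span`, p142582);
Chenevier's accumulation ⇒ the component of `V(J_𝒰)` through `z'` has dimension `≥ 1 + 2d = dim ℋ.R/P₀`;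
capture (`eq_bot_of_le_ringKrullDim_quotient`, p143302) ⇒ it IS `V(P₀)`.  (Points of a host have
determinant `σ ∘ det ρ` for finitely many `σ|_{E₀}`, so the fixed-determinant count applies componentwise.)
Size: XL (all inputs in print; none in the tree beyond the two landed helpers).
[cite: Chenevier2011, Thm E and §3] [cite: NewtonThorne2019, Thm 2 (Thm 5.6 for GL₂ over totally real F)]
[cite: Nakamura2010, Thm 1.4 and §2.4] [cite: KedlayaPottharstXiao2014, Thm 6.3.13]
[cite: BalasubramanyamGhateVatsal2013, Thm 1] [cite: Kisin2003, Prop. 9.5] [cite: Pan2022, Lemma 7.1.3] -/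
theorem stub_fernCapture :
    ∀ (F : Type) [Field F] [NumberField F], NumberField.IsTotallyReal F →
    ∀ (p : ℕ) [Fact p.Prime], 5 ≤ p → ¬ ((p : ℤ) ∣ NumberField.discr F) →
    ∀ (O : ValuationSubring (PadicAlgCl p)),
      O = (Valued.v : Valuation (PadicAlgCl p) NNReal).valuationSubring →
    ∀ (ρ : FramedGaloisRep F (PadicAlgCl p) 2) (ρ₀ : absoluteGaloisGroup F →* GL (Fin 2) O),
      ρ.HasUpperTriangularIntegralModel ρ₀ →
      (∀ᶠ v in cofinite, ρ.IsUnramifiedAt v) →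
      (∀ v : HeightOneSpectrum (𝓞 F), ((p : ℕ) : 𝓞 F) ∈ v.asIdeal → IsPDistinguishedAt ρ₀ v) →
    ∀ (ℋ : Host p O ρ ρ₀), IsNoetherianRing ℋ.R →
    ∀ (z : ℋ.R →+* PadicAlgCl p), Continuous z →
    ∀ (ρz : FramedGaloisRep F (PadicAlgCl p) 2),
      (∀ g, z (ℋ.T g) = ((ρz g : GL (Fin 2) (PadicAlgCl p)) : Matrix (Fin 2) (Fin 2) (PadicAlgCl p)).trace) →
      IsGoodPoint p ρz →
    ∀ P₀ ∈ minimalPrimes ℋ.R, P₀ ≤ RingHom.ker z →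
      (∀ P ∈ minimalPrimes ℋ.R, P ≤ RingHom.ker z → P = P₀) →
      ∃ 𝒰 : TameLevel 2 F p, badSet p ρ ⊆ 𝒰.bad ∧ proModularIdeal ℋ.R ℋ.T 𝒰 ≤ P₀ := by
  sorry

/-- **Stub S — `stub_seed` (THE SEED; hardest stub, open in part).**  Under ALL the hypotheses of the
crux (`F` totally real, `p ≥ 5`, `p ∤ disc F`, `O = 𝒪_{ℚ̄_p}`, `ρ` irreducible, totally odd, a.e.
unramified, `ρ₀` a residually upper-triangular `O`-model, `p`-distinguished at every `v ∣ p`) and for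
every NOETHERIAN host `ℋ`: some irreducible component of the generic fibre through the base point `x_ρ` — a
minimal prime `P₀` of `ℋ.R` below `ker ℋ.base` — carries a continuous point `z` whose trace function is
the trace of a GOOD representation (`IsGoodPoint`) and which lies on NO OTHER component (RESHAPE 4: `z` a smooth
point of the generic fibre — automatic on paper for Newton–Thorne-generic classical points with
`H²(G_{F,S}, ad⁰) = 0`, obtained by moving along the Hida leaf; the fern's capture step needs it).  Known route (in print, under extra hypotheses):
`dim ℋ.R/P₀ ≥ 1 + 2d` (Galois Euler characteristic, `ρ` irreducible odd: Pan Lemma 7.1.3); the nearly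
ordinary locus of `V(P₀)` is cut out placewise by the reducibility ideal of the local pseudo-deformation
ring (`≤ 2f_v − 1` equations), so its components have dimension `≥ 1 + #{v ∣ p}`, exceeding the globally
reducible locus (`≤ 2 + δ_F`) as soon as `#{v ∣ p} ≥ 2 + δ_F` — or `p` totally split, Pan §7.2–7.4 —; an
irreducible nearly ordinary point upgrades (Krull in `R_{b(ξ)}`) to a component finite over `Λ_F`, whose
regular de Rham points are dense and CLASSICAL by Skinner–Wiles / Pan Thm 5.1.2 when `F` is abelian and
`χ̄₁/χ̄₂` extends to `Γ_ℚ` with `χ̄|_{G_{F_v}} ≠ 1, ω^{±1}`; non-CM ones exist on any non-CM ordinary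
component.  OPEN: `#{v ∣ p} ≤ 1 + δ_F` (e.g. real quadratic `F`, `p` inert — the route's showcase) and
non-abelian `F` / `χ̄₁/χ̄₂` not from `Γ_ℚ` (Skinner–Wiles Thm B territory): exposure (β) of Disproof.lean,
shared by every line on this crux (TRIAGE-r1-3).  Size: XL.
[cite: Pan2022, Lemma 7.1.3, Lemma 7.2.1, Cor. 7.2.3, Thm 5.1.2] [cite: SkinnerWiles1999, Thm A]
[cite: Zhang2024, Thm 1.0.2] -/
theorem stub_seed :
    ∀ (F : Type) [Field F] [NumberField F], NumberField.IsTotallyReal F →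
    ∀ (p : ℕ) [Fact p.Prime], 5 ≤ p → ¬ ((p : ℤ) ∣ NumberField.discr F) →
    ∀ (O : ValuationSubring (PadicAlgCl p)),
      O = (Valued.v : Valuation (PadicAlgCl p) NNReal).valuationSubring →
    ∀ (ρ : FramedGaloisRep F (PadicAlgCl p) 2) (ρ₀ : absoluteGaloisGroup F →* GL (Fin 2) O),
      ρ.toGaloisRep.IsIrreducible → ρ.IsOdd → (∀ᶠ v in cofinite, ρ.IsUnramifiedAt v) →
      ρ.HasUpperTriangularIntegralModel ρ₀ →
      (∀ v : HeightOneSpectrum (𝓞 F), ((p : ℕ) : 𝓞 F) ∈ v.asIdeal → IsPDistinguishedAt ρ₀ v) →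
    ∀ (ℋ : Host p O ρ ρ₀), IsNoetherianRing ℋ.R →
      ∃ P₀ ∈ minimalPrimes ℋ.R, P₀ ≤ RingHom.ker ℋ.base ∧
      ∃ z : ℋ.R →+* PadicAlgCl p, Continuous z ∧
        ∃ ρz : FramedGaloisRep F (PadicAlgCl p) 2,
          (∀ g, z (ℋ.T g) = ((ρz g : GL (Fin 2) (PadicAlgCl p)) : Matrix (Fin 2) (Fin 2) (PadicAlgCl p)).trace) ∧
          IsGoodPoint p ρz ∧ P₀ ≤ RingHom.ker z ∧
          (∀ P ∈ minimalPrimes ℋ.R, P ≤ RingHom.ker z → P = P₀) := by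
  sorry

/-! ### The composition (kernel-checked, no `sorry` of its own) -/

/-- **The crux BY NAME from the five registered stubs BY NAME.**  The door hypothesis is introduced and
not used (crux ≡ `Q` as typed, Disproof.lean `proModularOfGKBound_iff_proModularity_of_door`).
Host (H) ⇒ `ℋ` with base point `x_ρ`; (N) ⇒ `ℋ.R` Noetherian; seed (S) ⇒ minimal `P₀ ≤ ker x_ρ` and a good
point `z` with `P₀ ≤ ker z`; fern (F) ⇒ `J_𝒰 ≤ P₀` for a tame level with `𝒰.bad ⊇ S`; so `J_𝒰 ≤ ker x_ρ`,
and closure (C) gives `𝒰.IsPadicallyAutomorphic ρ` (`ρ` is unramified outside `𝒰.bad ⊇ S`). [folklore] -/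
theorem ProModularOfGKBound_of : ProModularOfGKBound := by
  intro _hdoor F _ _ hF p _ hp hdisc O hO ρ ρ₀ hirr hodd hur hup hdist
  obtain ⟨ℋ⟩ := stub_host F p hp O hO ρ ρ₀ hup hur
  have hN : IsNoetherianRing ℋ.R := stub_noetherian F p hp O hO ρ ρ₀ hup hur ℋ
  obtain ⟨P₀, hP₀, hP₀b, z, hzc, ρz, hz, hgood, hP₀z, huniq⟩ :=
    stub_seed F hF p hp hdisc O hO ρ ρ₀ hirr hodd hur hup hdist ℋ hN
  obtain ⟨𝒰, hS, hJ⟩ :=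
    stub_fernCapture F hF p hp hdisc O hO ρ ρ₀ hup hur hdist ℋ hN z hzc ρz hz hgood P₀ hP₀ hP₀z huniq
  refine ⟨𝒰, stub_closure F p hp ℋ.R ℋ.mem_maximalIdeal ℋ.T ℋ.T.continuous 𝒰 ℋ.base
    ℋ.continuous_base ρ ℋ.base_spec ?_ (hJ.trans hP₀b)⟩
  intro v hv
  by_contra h
  exact hv (hS (Or.inl h))

/-- **The same composition as PURE LOGIC, hypothetical form**
`<H-sig> → <N-sig> → <C-sig> → <F-sig> → <S-sig> → ProModularOfGKBound` (sorry-free; an `example` so that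
the skeleton audit sees exactly one theorem concluding the crux). [folklore] -/
example
    (hH : ∀ (F : Type) [Field F] [NumberField F] (p : ℕ) [Fact p.Prime], 5 ≤ p →
      ∀ (O : ValuationSubring (PadicAlgCl p)),
        O = (Valued.v : Valuation (PadicAlgCl p) NNReal).valuationSubring →
      ∀ (ρ : FramedGaloisRep F (PadicAlgCl p) 2) (ρ₀ : absoluteGaloisGroup F →* GL (Fin 2) O),
        ρ.HasUpperTriangularIntegralModel ρ₀ →
        (∀ᶠ v in cofinite, ρ.IsUnramifiedAt v) →
        Nonempty (Host p O ρ ρ₀))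
    (hN : ∀ (F : Type) [Field F] [NumberField F] (p : ℕ) [Fact p.Prime], 5 ≤ p →
      ∀ (O : ValuationSubring (PadicAlgCl p)),
        O = (Valued.v : Valuation (PadicAlgCl p) NNReal).valuationSubring →
      ∀ (ρ : FramedGaloisRep F (PadicAlgCl p) 2) (ρ₀ : absoluteGaloisGroup F →* GL (Fin 2) O),
        ρ.HasUpperTriangularIntegralModel ρ₀ →
        (∀ᶠ v in cofinite, ρ.IsUnramifiedAt v) →
      ∀ (ℋ : Host p O ρ ρ₀), IsNoetherianRing ℋ.R)
    (hC : ∀ (F : Type) [Field F] [NumberField F] (p : ℕ) [Fact p.Prime], 5 ≤ p →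
      ∀ (R : Type) [CommRing R] [TopologicalSpace R] [IsTopologicalRing R] [CompactSpace R]
        [T2Space R] [IsLocalRing R],
        ((p : ℕ) : R) ∈ IsLocalRing.maximalIdeal R →
      ∀ (T : absoluteGaloisGroup F → R), Continuous T →
      ∀ (𝒰 : TameLevel 2 F p) (x : R →+* PadicAlgCl p), Continuous x →
      ∀ (ρ' : FramedGaloisRep F (PadicAlgCl p) 2),
        (∀ g, x (T g) = ((ρ' g : GL (Fin 2) (PadicAlgCl p)) : Matrix (Fin 2) (Fin 2) (PadicAlgCl p)).trace) →
        (∀ v, v ∉ 𝒰.bad → ρ'.IsUnramifiedAt v) →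
        proModularIdeal R T 𝒰 ≤ RingHom.ker x →
        𝒰.IsPadicallyAutomorphic ρ')
    (hF' : ∀ (F : Type) [Field F] [NumberField F], NumberField.IsTotallyReal F →
      ∀ (p : ℕ) [Fact p.Prime], 5 ≤ p → ¬ ((p : ℤ) ∣ NumberField.discr F) →
      ∀ (O : ValuationSubring (PadicAlgCl p)),
        O = (Valued.v : Valuation (PadicAlgCl p) NNReal).valuationSubring →
      ∀ (ρ : FramedGaloisRep F (PadicAlgCl p) 2) (ρ₀ : absoluteGaloisGroup F →* GL (Fin 2) O),
        ρ.HasUpperTriangularIntegralModel ρ₀ →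
        (∀ᶠ v in cofinite, ρ.IsUnramifiedAt v) →
        (∀ v : HeightOneSpectrum (𝓞 F), ((p : ℕ) : 𝓞 F) ∈ v.asIdeal → IsPDistinguishedAt ρ₀ v) →
      ∀ (ℋ : Host p O ρ ρ₀), IsNoetherianRing ℋ.R →
      ∀ (z : ℋ.R →+* PadicAlgCl p), Continuous z →
      ∀ (ρz : FramedGaloisRep F (PadicAlgCl p) 2),
        (∀ g, z (ℋ.T g) = ((ρz g : GL (Fin 2) (PadicAlgCl p)) : Matrix (Fin 2) (Fin 2) (PadicAlgCl p)).trace) →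
        IsGoodPoint p ρz →
      ∀ P₀ ∈ minimalPrimes ℋ.R, P₀ ≤ RingHom.ker z →
        (∀ P ∈ minimalPrimes ℋ.R, P ≤ RingHom.ker z → P = P₀) →
        ∃ 𝒰 : TameLevel 2 F p, badSet p ρ ⊆ 𝒰.bad ∧ proModularIdeal ℋ.R ℋ.T 𝒰 ≤ P₀)
    (hS' : ∀ (F : Type) [Field F] [NumberField F], NumberField.IsTotallyReal F →
      ∀ (p : ℕ) [Fact p.Prime], 5 ≤ p → ¬ ((p : ℤ) ∣ NumberField.discr F) →
      ∀ (O : ValuationSubring (PadicAlgCl p)),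
        O = (Valued.v : Valuation (PadicAlgCl p) NNReal).valuationSubring →
      ∀ (ρ : FramedGaloisRep F (PadicAlgCl p) 2) (ρ₀ : absoluteGaloisGroup F →* GL (Fin 2) O),
        ρ.toGaloisRep.IsIrreducible → ρ.IsOdd → (∀ᶠ v in cofinite, ρ.IsUnramifiedAt v) →
        ρ.HasUpperTriangularIntegralModel ρ₀ →
        (∀ v : HeightOneSpectrum (𝓞 F), ((p : ℕ) : 𝓞 F) ∈ v.asIdeal → IsPDistinguishedAt ρ₀ v) →
      ∀ (ℋ : Host p O ρ ρ₀), IsNoetherianRing ℋ.R →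
        ∃ P₀ ∈ minimalPrimes ℋ.R, P₀ ≤ RingHom.ker ℋ.base ∧
        ∃ z : ℋ.R →+* PadicAlgCl p, Continuous z ∧
          ∃ ρz : FramedGaloisRep F (PadicAlgCl p) 2,
            (∀ g, z (ℋ.T g) = ((ρz g : GL (Fin 2) (PadicAlgCl p)) : Matrix (Fin 2) (Fin 2) (PadicAlgCl p)).trace) ∧
            IsGoodPoint p ρz ∧ P₀ ≤ RingHom.ker z ∧
            (∀ P ∈ minimalPrimes ℋ.R, P ≤ RingHom.ker z → P = P₀)) :
    ProModularOfGKBound := by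
  intro _hdoor F _ _ hF p _ hp hdisc O hO ρ ρ₀ hirr hodd hur hup hdist
  obtain ⟨ℋ⟩ := hH F p hp O hO ρ ρ₀ hup hur
  have hNt : IsNoetherianRing ℋ.R := hN F p hp O hO ρ ρ₀ hup hur ℋ
  obtain ⟨P₀, hP₀, hP₀b, z, hzc, ρz, hz, hgood, hP₀z, huniq⟩ :=
    hS' F hF p hp hdisc O hO ρ ρ₀ hirr hodd hur hup hdist ℋ hNt
  obtain ⟨𝒰, hS, hJ⟩ := hF' F hF p hp hdisc O hO ρ ρ₀ hup hur hdist ℋ hNt z hzc ρz hz hgood P₀ hP₀ hP₀z huniq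
  refine ⟨𝒰, hC F p hp ℋ.R ℋ.mem_maximalIdeal ℋ.T ℋ.T.continuous 𝒰 ℋ.base ℋ.continuous_base ρ
    ℋ.base_spec ?_ (hJ.trans hP₀b)⟩
  intro v hv
  by_contra h
  exact hv (hS (Or.inl h))

end Summit.Langlands.Langlands.Cruxes.ProModularOfGKBound.TwoLeafFern

end
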